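import Literature.AlgebraicTopology.SingularHomology.DeformationRetractHomology
import HarnessLib

/-!
# A deformation retraction preserving a subspace induces isomorphisms on relative homology

A variant of `DeformationRetractHomology.lean` (Hatcher, *Algebraic Topology* (2002), §2.1,
Prop. 2.19 with Ch. 0, p. 2) in which the subspace of the pair is only *preserved*, not fixed, by
the deformation: if `H : [0, 1] × S → S` is a deformation retraction of `S` onto `A` fixing `A`
pointwise (`H₀ = 𝟙`, `H₁(S) ⊆ A`, `H_t = 𝟙` on `A`) and `H_t(V) ⊆ V` for all `t`, then the
inclusion of pairs `(A, A ∩ V) → (S, V)` is a homotopy equivalence of pairs (inverse `H₁`, the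
deformation being a homotopy of pairs `(S, V) → (S, V)`), hence
**`Hₙ(A, A ∩ V) ≅ Hₙ(S, V)` for all `n`**.  This is the form needed to replace a "thick" subspace
by a level, e.g. `({c₀ - ε ≤ f ≤ c₁}, {c₀ - ε ≤ f ≤ c₀}) ≃ ({c₀ ≤ f ≤ c₁}, {f = c₀})` by flowing
along a gradient-like field (Milnor 1965, Thm. 3.4, as used for `H⁎(W_λ, W_{λ-1})` on PDF p. 46).

## Main result

* `Literature.AlgebraicTopology.SingularHomology.relativeSingularHomology.isIso_map_of_deformation`.

## References

* A. Hatcher, *Algebraic Topology*, CUP 2002, Ch. 0, p. 2 and §2.1, Prop. 2.19 (p. 118).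
  [HatcherAT2002]
-/

noncomputable section

open CategoryTheory Limits Set unitInterval

universe u v

namespace Literature.AlgebraicTopology.SingularHomology

variable (R : Type v) [CommRing R] (M : Type v) [AddCommGroup M] [Module R M]
variable {S : Type u} [TopologicalSpace S]

namespace relativeSingularHomology

/-- The end `r = H₁ : S → A` of a deformation of `S` into `A`, as a continuous map. [folklore] -/
def deformationEnd (A : Set S) (H : C(I × S, S)) (h1 : ∀ x, H (1, x) ∈ A) : C(S, ↥A) :=
  ⟨fun x => ⟨H (1, x), h1 x⟩, (H.continuous.comp (Continuous.prodMk_right 1)).subtype_mk _⟩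

/-- `deformationEnd` is `H₁` on points. [folklore] -/
@[simp]
theorem coe_deformationEnd_apply (A : Set S) (H : C(I × S, S)) (h1 : ∀ x, H (1, x) ∈ A) (x : S) :
    (deformationEnd A H h1 x : S) = H (1, x) :=
  rfl

/-- If `H_t(V) ⊆ V`, the end `r = H₁` is a map of pairs `(S, V) → (A, A ∩ V)`. [folklore] -/
theorem mapsTo_deformationEnd (A : Set S) {V : Set S} (H : C(I × S, S)) (h1 : ∀ x, H (1, x) ∈ A)
    (hV : ∀ (t : I), ∀ x ∈ V, H (t, x) ∈ V) :
    MapsTo (deformationEnd A H h1) V (Subtype.val ⁻¹' V : Set ↥A) :=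
  fun x hx => hV 1 x hx

/-- The inclusion `A ⊆ S` is a map of pairs `(A, A ∩ V) → (S, V)`. [folklore] -/
theorem mapsTo_subsetIncl_preimage (A V : Set S) :
    MapsTo (subsetIncl A) (Subtype.val ⁻¹' V : Set ↥A) V :=
  fun _ hx => hx

/-- The identity of `S` is a map of pairs `(S, V) → (S, V)`. [folklore] -/
theorem mapsTo_id' (V : Set S) : MapsTo (ContinuousMap.id S) V V := mapsTo_id V

/-- **A deformation retraction of `S` onto `A` that preserves `V` induces isomorphisms
`Hₙ(A, A ∩ V) ≅ Hₙ(S, V)`** (Hatcher 2002, §2.1, Prop. 2.19 with Ch. 0, p. 2: the inclusion of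
pairs `(A, A ∩ V) → (S, V)` has the homotopy inverse `H₁`, since `H₁ ∘ i = 𝟙` and
`i ∘ H₁ = H₁ ≃ H₀ = 𝟙` through maps of pairs `(S, V) → (S, V)`).  Here `H : [0, 1] × S → S` with
`H₀ = 𝟙`, `H₁(S) ⊆ A`, `H_t = 𝟙` on `A` and `H_t(V) ⊆ V` for all `t`.
[cite: HatcherAT2002, §2.1, Prop. 2.19 (p. 118), with Ch. 0, p. 2] -/
theorem isIso_map_of_deformation (A : Set S) {V : Set S} (H : C(I × S, S)) (h0 : ∀ x, H (0, x) = x)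
    (h1 : ∀ x, H (1, x) ∈ A) (hfix : ∀ (t : I), ∀ x ∈ A, H (t, x) = x)
    (hV : ∀ (t : I), ∀ x ∈ V, H (t, x) ∈ V) (n : ℕ) :
    IsIso (map R M (subsetIncl A) (mapsTo_subsetIncl_preimage A V) n) := by
  -- `i ∘ r = H₁ ≃ 𝟙` through maps of pairs
  let F : ContinuousMap.Homotopy (ContinuousMap.id S) ((subsetIncl A).comp (deformationEnd A H h1)) :=
    { toFun := H
      continuous_toFun := H.continuous
      map_zero_left := h0
      map_one_left := fun _ => rfl }
  have hri : map R M (deformationEnd A H h1) (mapsTo_deformationEnd A H h1 hV) n ≫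
      map R M (subsetIncl A) (mapsTo_subsetIncl_preimage A V) n = 𝟙 _ := by
    rw [← map_comp, ← map_eq_of_homotopic_holds R M (mapsTo_id' V) _ F (fun tx htx => hV tx.1 tx.2 htx) n,
      map_id]
  -- `r ∘ i = 𝟙`
  have hir : map R M (subsetIncl A) (mapsTo_subsetIncl_preimage A V) n ≫
      map R M (deformationEnd A H h1) (mapsTo_deformationEnd A H h1 hV) n = 𝟙 _ := by
    rw [← map_comp, map_congr R M (f' := ContinuousMap.id ↥A)
      (by ext y; exact hfix 1 y y.2) _ (mapsTo_id _), map_id]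
  exact ⟨⟨map R M (deformationEnd A H h1) (mapsTo_deformationEnd A H h1 hV) n, hir, hri⟩⟩

end relativeSingularHomology

end Literature.AlgebraicTopology.SingularHomology
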